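import Summits.QuantumFields.YangMills.Theorems.BalabanUVNodesN21GappedTopPair13CoPHDefs

/-!
# N21 (NE7c) · THE GAPPED TOP CUT FOR BOTH INDICATOR FAMILIES OF THE LAST 𝐓-STEP — definition lane, part 2: the PAIR-LETTERED term (the (3.2) letter `θ`
# AND the (3.3) letter `δ′` of the last step freed), the DOUBLY-GAPPED label ∕ step weights, the doubly-gapped top slot ∕ core, and the TWO-COLLAR shell

WIDTH SEAT `pub-ymgap-dag-n21-w7` (g2), node N21 = NE7c (NOT PRINTED; NOT proved at print's fixed thresholds); lane K3⁷ `SpineGivenEndpointR13SepCoPH`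
(stmt-QuantumFields-20544, `--supports … --as helper`; COUNT-NEUTRAL).  DEFINITION LANE: `def`s + faces; NO estimate.  Imports part 1 `…N21GappedTopPair13CoPHDefs`
(`bFactorAt`, `bGapAt`, `collarBAt`; through it U1 `…N21GappedTopCut13CoPHDefs` p617809: `aGapAt`, `ωGapAt`, `wGapAt`; T1 `…N21SelectedTopCut13CoPHDefs`: `topLetter`,
`wTopAt`, `topSlotAt`, `topClassWeightAt`; def-T FILE 19 `Node00/StepWeightsAtThresholds`: `ωOfRecordAt`, `wOfRecordAt`, `twoDeltaLetterOfRecord`, `tstepOfRecordAt`;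
def-T FILE 2 `stepWeightsOfResum ∕ resumWeights`).  The OBJECT half of the (3.3) family accepted from the lane owner dag-n21-d g11 (OFFER-2, cell bus 2026-08-28 10:02Z;
interface note (i): «build the JOINT label weight with BOTH gaps»).  WHY: see part 1's header — under `T4IndicatorShell` design (i) both background-mediated families of
the last 𝐓-step need a two-sided collar; at the MAJORANT level the two families separate and the two depths are selected independently ((M1)-FREE; sequel files).

WHAT IS DEFINED (NODE 00's generality `ϑ D g₀ os p g k`; the top is level `k + 1`, meant at `k + 1 = p.K`).
* §B3 the PAIR-LETTERED term: `topBLetter ϑ δ′` (the (3.3) letter reading `δ′` at the last step `j + 1 = p.K` and print's `2δ_j` below), ★ `wTop2At ϑ θ δ′ :=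
  wOfRecordAt (topLetter ϑ.ν θ) (topBLetter ϑ δ′) ϑ.ζ` (def-T's lettered step weights — `isStepUnity_wOfRecordAt`, `abs_wOfRecordAt_le_one`, `measurable_wOfRecordAt`
  apply BY NAME; `wTop2At_apply_top`), `topSlot2At θ δ′`, `topClassWeight2At θ δ′` (T1's `topSlotAt ∕ topClassWeightAt` with the (3.3) letter freed; `_apply`).
* §B4 the DOUBLY-GAPPED weights: ★ `ωGap2At θlo θhi δlo δhi ζ s t := aGapAt θlo θhi s t.1 · bGapAt δlo δhi s t.1 t.2.1 · ζ(t)` (`ωGap2At θlo θhi δ δ = ωGapAt θlo θhi δ`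
  and `ωGap2At θ θ δ δ = ωOfRecordAt θ δ`, both `rfl`), ★ `wGap2At ϑ θlo θhi δlo δhi : StepWeightsOfRecord` (resummed along `σOfRecord`, U1's pattern; `_apply`,
  `_nonneg` at `0 ≤ ζ`, `sum_abs_ωGap2At_le_one` and `abs_wGap2At_le_one` for `θlo ≤ θhi`, `δlo ≤ δhi`, `Σ|ζ| ≤ 1`, `measurable_ωGap2At ∕ _wGap2At` under (H-ζ)).
* §B5 ★ `topGap2SlotAt θlo θhi δlo δhi` (front factor `topLetter ϑ.ν θlo`), `topGap2CoreAt := ∫ χ_{k+1}^{θlo}(s′)·topGap2Slot` (NO top (3.2) statistic in `(θlo, θhi)` and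
  NO top (3.3) statistic in `(δlo, δhi)`), ★ `topGap2ShellAt θlo θ θhi δlo δ′ δhi := topClassWeight2At θ δ′ − topGap2CoreAt θlo θhi δlo δhi` (the TWO-COLLAR shell);
  `_apply`, `shell + core = term`, `0 ≤ slot ∕ core`, `shell ≤ term`.

HONEST FRAMING (binding).  Definitions + [folklore] bookkeeping over NODE 00's objects of record; NO estimate of Bałaban's asserted or used; the residual `ζ` ∕ (3.5),
the ℝ-side, the selector and everything below the top step are print's ∕ the record's (LOCATED); the top 𝐑-step is omitted as in T1 ∕ U1; the common-refinement
inequality and the core sandwich are the CONSUMER's; no lettered spine READING typed here; no `Provisos₁₃CoPH` inhabitant claimed (K0⁷ open); NE7c NOT PRINTED ∕ NOT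
proved at print's fixed thresholds; N21 NOT discharged; K3⁷ NOT claimed; counts UNMOVED (typed 28∕28 · discharged 5∕27, A 5∕28); never a count claim.  No `sorry`, no
`axiom`, no `instance`, no `notation`.  One finite four-torus programme at fixed `ε` — NOT ℝ⁴, NOT OS, NOT a mass gap, NOT the Clay problem.
-/

noncomputable section

open scoped BigOperators
open Finset MeasureTheory

namespace Summit.QuantumFields.YangMills.Theorems.N21GappedTopPair13CoPH

open Literature.MathematicalPhysics.QuantumFieldTheory.Balaban1983to89
open Literature.MathematicalPhysics.QuantumFieldTheory.Balaban1983to89.T4Continuum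
open Literature.MathematicalPhysics.QuantumFieldTheory.Balaban1983to89.Node00
open Summit.QuantumFields.YangMills.BalabanUVNodes.N19MGFRoadLiveSelectorTower (dressedSlotsOfDatum₉_nonneg)
open Summit.QuantumFields.YangMills.BalabanUVNodes.N19MGFFormAtRecord (wOfRecord₉_nonneg)
open Summit.QuantumFields.YangMills.Theorems.N21ShellSplitOfRecord13CoPH

/-! ## §B3 The pair-lettered term: the (3.2) letter `θ` AND the (3.3) letter `δ′` of the last 𝐓-step freed -/

section PairLettered

variable (F : T4Family) (N : ℕ) [NeZero N]

/-- **THE TOP (3.3) LETTER**: the (3.3) threshold letter reading `δ′` at the last step (old level `j` with `j + 1 = p.K`) and print's `2δ_j` of record at every other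
step. [bookkeeping] -/
def topBLetter (ϑ : Stage9Params F N) (δ' : ℝ) : ThresholdLetter :=
  fun p g j => if j + 1 = p.K then δ' else twoDeltaLetterOfRecord ϑ.ν ϑ.A₁ p g j

/-- Face: at the last step the top (3.3) letter reads `δ′`. [bookkeeping] -/
theorem topBLetter_top (ϑ : Stage9Params F N) (δ' : ℝ) (p : B12.RunParams) (g : ℕ → ℝ) {k : ℕ} (hk : k + 1 = p.K) : topBLetter F N ϑ δ' p g k = δ' := by
  simp [topBLetter, hk]

/-- Face: off the last step the top (3.3) letter reads print's `2δ_j`. [bookkeeping] -/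
theorem topBLetter_of_ne (ϑ : Stage9Params F N) (δ' : ℝ) (p : B12.RunParams) (g : ℕ → ℝ) {j : ℕ} (hj : j + 1 ≠ p.K) :
    topBLetter F N ϑ δ' p g j = twoDeltaLetterOfRecord ϑ.ν ϑ.A₁ p g j := by
  simp [topBLetter, hj]

/-- ★ **THE PAIR-LETTERED STEP WEIGHTS**: def-T's step weights at letters with the (3.2) letter `topLetter ν θ` AND the (3.3) letter `topBLetter ϑ δ′` (so ONLY the
last step reads `(θ, δ′)`); def-T's three provisos (`isStepUnity_wOfRecordAt`, `abs_wOfRecordAt_le_one`, `measurable_wOfRecordAt`) apply BY NAME. T1's `wTopAt ϑ θ` is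
the companion with the (3.3) letters of record. [bookkeeping] -/
def wTop2At (ϑ : Stage9Params F N) (θ δ' : ℝ) : StepWeightsOfRecord F N ϑ.ν ϑ.τ9.M :=
  wOfRecordAt F N ϑ.ν ϑ.τ9.M (topLetter ϑ.ν θ) (topBLetter F N ϑ δ') ϑ.ζ

variable (ϑ : Stage9Params F N) (D : FiniteEpsData F (SU N)) (g₀ : ℕ → ℝ) (os : List (ULoop F)) (p : B12.RunParams) (g : ℕ → ℝ) (k : ℕ)

/-- Unfolding of `wTop2At` at the last step `(p, g, k)`, `k + 1 = p.K`: the resummation of def-T's label weights at the letter pair `(θ, δ′)`. [bookkeeping] -/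
theorem wTop2At_apply_top (hk : k + 1 = p.K) (θ δ' : ℝ) :
    wTop2At F N ϑ θ δ' p g k = resumWeights (σOfRecord F ϑ.ν ϑ.τ9.M p g k) (ωOfRecordAt F N ϑ.ν ϑ.τ9.M p g k θ δ' ϑ.ζ) := by
  have htop : topLetter ϑ.ν θ p g (k + 1) = θ := by rw [hk]; exact topLetter_top ϑ.ν θ p g
  rw [wTop2At, wOfRecordAt_apply, topBLetter_top F N ϑ δ' p g hk, htop]

/-- ★ **THE PAIR-LETTERED (pre-𝐑) SLOT** of a level-`(k+1)` history `s′` at source `t`: the 𝐓-step at the letters `(topLetter ϑ.ν θ, topBLetter ϑ δ′)` of the run's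
dressed level-`k` slots OF RECORD — T1's `topSlotAt θ` with the (3.3) letter freed. [bookkeeping] -/
def topSlot2At (θ δ' t : ℝ) (s' : SeqOfRecord F ϑ.ν ϑ.τ9.M g p.K (k + 1)) : GaugeField (F.P p.K) (k + 1) (SU N) → ℝ :=
  tstepOfRecordAt F N ϑ.ν ϑ.τ9.M (topLetter ϑ.ν θ) (wTop2At F N ϑ θ δ') p g k (dressedSlotsOfDatum₉ F N ϑ D g₀ os t p g k) s'

/-- **THE PAIR-LETTERED CLASS WEIGHT** of `s′`: `∫ χ_{k+1}^{θ}(Ω_{k+1}(s′))·topSlot2^{θ,δ′}(s′) dV`. [bookkeeping] -/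
def topClassWeight2At (θ δ' t : ℝ) (s' : SeqOfRecord F ϑ.ν ϑ.τ9.M g p.K (k + 1)) : ℝ :=
  ∫ V, chiSeqOfRecordAt F N ϑ.ν ϑ.τ9.M g p.K (k + 1) θ s' V * topSlot2At F N ϑ D g₀ os p g k θ δ' t s' V ∂fieldMeasure (F.P p.K) (k + 1) (SU N)

/-- Unfolding of the pair-lettered slot through def-T's `tstepOfRecordAt_apply`. [bookkeeping] -/
theorem topSlot2At_apply (θ δ' t : ℝ) (s' : SeqOfRecord F ϑ.ν ϑ.τ9.M g p.K (k + 1)) (V : GaugeField (F.P p.K) (k + 1) (SU N)) :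
    topSlot2At F N ϑ D g₀ os p g k θ δ' t s' V =
      transportOfRecord F N p.K k (fun U => wTop2At F N ϑ θ δ' p g k s' U V *
        (chiSeqOfRecordAt F N ϑ.ν ϑ.τ9.M g p.K k (topLetter ϑ.ν θ p g k) s'.init U * dressedSlotsOfDatum₉ F N ϑ D g₀ os t p g k s'.init U)) V :=
  tstepOfRecordAt_apply F N ϑ.ν ϑ.τ9.M (topLetter ϑ.ν θ) (wTop2At F N ϑ θ δ') p g k _ s' V

end PairLettered

/-! ## §B4 The doubly-gapped label ∕ step weights -/

section Gap2Weight

variable (F : T4Family) (N : ℕ) [NeZero N] (ν : Stage7Numerics) (M : ℕ) (p : B12.RunParams) (g : ℕ → ℝ) (k : ℕ)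

/-- ★ **THE DOUBLY-GAPPED LABEL WEIGHT** `ωGap2 s t (U, V′) := aGap(θlo,θhi)(t.1)(V′) · bGap(δlo,δhi)(t.1, t.2.1)(U, V′) · ζ(t)(U, V′)` — U1's `ωGapAt θlo θhi δ′` with the (3.3)
weight gapped as well (lane owner's interface note (i)); the residual `ζ` untouched. [bookkeeping] -/
def ωGap2At (θlo θhi δlo δhi : ℝ) (ζ : ZetaOfRecord F N ν M) (s : SeqOfRecord F ν M g p.K k) (t : LbOfRecord F ν p g k)
    (U : GaugeField (F.P p.K) k (SU N)) (V' : GaugeField (F.P p.K) (k + 1) (SU N)) : ℝ :=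
  aGapAt F N ν M p g k θlo θhi s t.1 V' * bGapAt F N ν M p g k δlo δhi s t.1 t.2.1 U V' * ζ p g k s t.1 t.2.1 t.2.2 U V'

/-- Face: with equal (3.3) letters the doubly-gapped weight IS U1's `ωGapAt` (definitional). [bookkeeping] -/
theorem ωGap2At_selfB (θlo θhi δ : ℝ) (ζ : ZetaOfRecord F N ν M) : ωGap2At F N ν M p g k θlo θhi δ δ ζ = ωGapAt F N ν M p g k θlo θhi δ ζ := rfl

/-- Face: with both letter pairs equal it IS def-T's `ωOfRecordAt θ δ` (definitional). [bookkeeping] -/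
theorem ωGap2At_self (θ δ : ℝ) (ζ : ZetaOfRecord F N ν M) : ωGap2At F N ν M p g k θ θ δ δ ζ = ωOfRecordAt F N ν M p g k θ δ ζ := rfl

end Gap2Weight

section Step2Weights

variable (F : T4Family) (N : ℕ) [NeZero N] (ϑ : Stage9Params F N)

/-- ★ **THE DOUBLY-GAPPED STEP WEIGHTS** `wGap2At ϑ θlo θhi δlo δhi : StepWeightsOfRecord`: def-T FILE 2's resummation along `σOfRecord` of the doubly-gapped label
weights with the residual `ζ` OF RECORD (U1's `wGapAt` pattern; the same gap letters at every step, only the last step is ever read). [bookkeeping] -/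
def wGap2At (θlo θhi δlo δhi : ℝ) : StepWeightsOfRecord F N ϑ.ν ϑ.τ9.M :=
  stepWeightsOfResum F N ϑ.ν ϑ.τ9.M (LbOfRecord F ϑ.ν) (σOfRecord F ϑ.ν ϑ.τ9.M)
    (fun p g k => ωGap2At F N ϑ.ν ϑ.τ9.M p g k θlo θhi δlo δhi ϑ.ζ)

variable (p : B12.RunParams) (g : ℕ → ℝ) (k : ℕ)

/-- Unfolding of `wGap2At` at `(p, g, k)`. [bookkeeping] -/
theorem wGap2At_apply (θlo θhi δlo δhi : ℝ) :
    wGap2At F N ϑ θlo θhi δlo δhi p g k = resumWeights (σOfRecord F ϑ.ν ϑ.τ9.M p g k) (ωGap2At F N ϑ.ν ϑ.τ9.M p g k θlo θhi δlo δhi ϑ.ζ) := rfl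

/-- `0 ≤` the doubly-gapped step weights at `0 ≤ ζ`. [bookkeeping] -/
theorem wGap2At_nonneg (hζ0 : ∀ p g k s Pl Ql RS U V', 0 ≤ ϑ.ζ p g k s Pl Ql RS U V') (θlo θhi δlo δhi : ℝ)
    (s' : SeqOfRecord F ϑ.ν ϑ.τ9.M g p.K (k + 1)) (U : GaugeField (F.P p.K) k (SU N)) (V' : GaugeField (F.P p.K) (k + 1) (SU N)) :
    0 ≤ wGap2At F N ϑ θlo θhi δlo δhi p g k s' U V' := by
  classical
  rw [wGap2At_apply]
  unfold resumWeights
  refine Finset.sum_nonneg fun t _ => ?_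
  unfold ωGap2At
  exact mul_nonneg (mul_nonneg (aGapAt_nonneg F N ϑ.ν ϑ.τ9.M p g k _ _ _ _ _) (bGapAt_nonneg F N ϑ.ν ϑ.τ9.M p g k _ _ _ _ _ _ _))
    (hζ0 _ _ _ _ _ _ _ _ _)

/-- `Σ_t |ωGap2 s t| ≤ 1` at `Σ|ζ| ≤ 1`, for `θlo ≤ θhi` and `δlo ≤ δhi`: the doubly-gapped weight is below `a|_{θlo}·b|_{δlo}·|ζ|` termwise, and def-T's (O3) at the letter
pair `(θlo, δlo)`. [bookkeeping] -/
theorem sum_abs_ωGap2At_le_one (hζ1 : IsZetaAbsLeOne F N ϑ.ν ϑ.τ9.M ϑ.ζ) {θlo θhi δlo δhi : ℝ} (hθ : θlo ≤ θhi) (hδ : δlo ≤ δhi)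
    (s : SeqOfRecord F ϑ.ν ϑ.τ9.M g p.K k) (U : GaugeField (F.P p.K) k (SU N)) (V' : GaugeField (F.P p.K) (k + 1) (SU N)) :
    ∑ t : LbOfRecord F ϑ.ν p g k, |ωGap2At F N ϑ.ν ϑ.τ9.M p g k θlo θhi δlo δhi ϑ.ζ s t U V'| ≤ 1 := by
  refine le_trans (Finset.sum_le_sum fun t _ => ?_) (sum_abs_ωOfRecordAt_le_one F N ϑ.ν ϑ.τ9.M p g k θlo δlo hζ1 s U V')
  unfold ωGap2At ωOfRecordAt
  rw [abs_mul, abs_mul, abs_mul, abs_mul, abs_of_nonneg (aGapAt_nonneg F N ϑ.ν ϑ.τ9.M p g k _ _ _ _ _),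
    abs_of_nonneg (aWeightAt_nonneg F N ϑ.ν ϑ.τ9.M p g k _ _ _ _), abs_of_nonneg (bGapAt_nonneg F N ϑ.ν ϑ.τ9.M p g k _ _ _ _ _ _ _),
    abs_of_nonneg (bWeightAt_nonneg F N ϑ.ν ϑ.τ9.M p g k _ _ _ _ _ _)]
  exact mul_le_mul_of_nonneg_right (mul_le_mul (aGapAt_le_aWeightAt F N ϑ.ν ϑ.τ9.M p g k le_rfl hθ _ _ _)
    (bGapAt_le_bWeightAt F N ϑ.ν ϑ.τ9.M p g k le_rfl hδ _ _ _ _ _) (bGapAt_nonneg F N ϑ.ν ϑ.τ9.M p g k _ _ _ _ _ _ _)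
    (aWeightAt_nonneg F N ϑ.ν ϑ.τ9.M p g k _ _ _ _)) (abs_nonneg _)

/-- `|wGap2| ≤ 1` at `Σ|ζ| ≤ 1`, `θlo ≤ θhi`, `δlo ≤ δhi` (def-T FILE 2 `abs_resumWeights_le_one`). [bookkeeping] -/
theorem abs_wGap2At_le_one (hζ1 : IsZetaAbsLeOne F N ϑ.ν ϑ.τ9.M ϑ.ζ) {θlo θhi δlo δhi : ℝ} (hθ : θlo ≤ θhi) (hδ : δlo ≤ δhi)
    (s' : SeqOfRecord F ϑ.ν ϑ.τ9.M g p.K (k + 1)) (U : GaugeField (F.P p.K) k (SU N)) (V' : GaugeField (F.P p.K) (k + 1) (SU N)) :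
    |wGap2At F N ϑ θlo θhi δlo δhi p g k s' U V'| ≤ 1 := by
  rw [wGap2At_apply]
  exact abs_resumWeights_le_one _ _ (fun s U V' => sum_abs_ωGap2At_le_one F N ϑ p g k hζ1 hθ hδ s U V') s' U V'

/-- the doubly-gapped label weights are jointly measurable under (H-ζ) ((H-U) absolute). [bookkeeping] -/
theorem measurable_ωGap2At (hζm : ZetaMeasurable F N ϑ.ζ) (θlo θhi δlo δhi : ℝ) (s : SeqOfRecord F ϑ.ν ϑ.τ9.M g p.K k) (t : LbOfRecord F ϑ.ν p g k) :
    Measurable (fun z : GaugeField (F.P p.K) (k + 1) (SU N) × GaugeField (F.P p.K) k (SU N) =>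
      ωGap2At F N ϑ.ν ϑ.τ9.M p g k θlo θhi δlo δhi ϑ.ζ s t z.2 z.1) := by
  unfold ωGap2At
  exact (((measurable_aGapAt F N ϑ p g k θlo θhi s t.1).comp measurable_fst).mul
    (measurable_bGapAt F N ϑ.ν ϑ.τ9.M p g k δlo δhi s t.1 t.2.1)).mul (hζm p g k s t.1 t.2.1 t.2.2)

/-- the doubly-gapped step weights are jointly measurable under (H-ζ) (def-T FILE 2 `measurable_resumWeights`). [bookkeeping] -/
theorem measurable_wGap2At (hζm : ZetaMeasurable F N ϑ.ζ) (θlo θhi δlo δhi : ℝ) (s' : SeqOfRecord F ϑ.ν ϑ.τ9.M g p.K (k + 1)) :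
    Measurable (fun z : GaugeField (F.P p.K) (k + 1) (SU N) × GaugeField (F.P p.K) k (SU N) => wGap2At F N ϑ θlo θhi δlo δhi p g k s' z.2 z.1) := by
  rw [wGap2At_apply]
  exact measurable_resumWeights _ _ (fun s t => measurable_ωGap2At F N ϑ p g k hζm θlo θhi δlo δhi s t) s'

end Step2Weights

/-! ## §B5 The doubly-gapped top slot, core and the two-collar shell -/

section Gap2Top

variable (F : T4Family) (N : ℕ) [NeZero N] (ϑ : Stage9Params F N) (D : FiniteEpsData F (SU N)) (g₀ : ℕ → ℝ) (os : List (ULoop F))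
  (p : B12.RunParams) (g : ℕ → ℝ) (k : ℕ)

/-- ★ **THE DOUBLY-GAPPED TOP SLOT** of a level-`(k+1)` history `s′` at source `t`: the 𝐓-step of the run's dressed level-`k` slots OF RECORD with the doubly-gapped step
weights (old front factor at `topLetter ν θlo`). [bookkeeping] -/
def topGap2SlotAt (θlo θhi δlo δhi t : ℝ) (s' : SeqOfRecord F ϑ.ν ϑ.τ9.M g p.K (k + 1)) : GaugeField (F.P p.K) (k + 1) (SU N) → ℝ :=
  tstepOfRecordAt F N ϑ.ν ϑ.τ9.M (topLetter ϑ.ν θlo) (wGap2At F N ϑ θlo θhi δlo δhi) p g k (dressedSlotsOfDatum₉ F N ϑ D g₀ os t p g k) s'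

/-- **THE DOUBLY-GAPPED CORE** of `s′`: `∫ χ_{k+1}^{θlo}(Ω_{k+1}(s′))·topGap2Slot(s′) dV` — NO top (3.2) statistic in `(θlo, θhi)` and NO top (3.3) statistic in `(δlo, δhi)`.
[bookkeeping] -/
def topGap2CoreAt (θlo θhi δlo δhi t : ℝ) (s' : SeqOfRecord F ϑ.ν ϑ.τ9.M g p.K (k + 1)) : ℝ :=
  ∫ V, chiSeqOfRecordAt F N ϑ.ν ϑ.τ9.M g p.K (k + 1) θlo s' V * topGap2SlotAt F N ϑ D g₀ os p g k θlo θhi δlo δhi t s' V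
    ∂fieldMeasure (F.P p.K) (k + 1) (SU N)

/-- ★ **THE TWO-COLLAR SHELL** of the pair-lettered term at `(θ, δ′)` with collars `(θlo, θhi)`, `(δlo, δhi)`: `topClassWeight2^{θ,δ′}(s′) − topGap2Core(s′)` — for
`θlo ≤ θ ≤ θhi`, `δlo ≤ δ′ ≤ δhi` the part of the term on which SOME top (3.2) statistic lies in `(θlo, θhi)` or SOME top (3.3) statistic lies in `(δlo, δhi)`. [bookkeeping] -/
def topGap2ShellAt (θlo θ θhi δlo δ' δhi t : ℝ) (s' : SeqOfRecord F ϑ.ν ϑ.τ9.M g p.K (k + 1)) : ℝ :=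
  topClassWeight2At F N ϑ D g₀ os p g k θ δ' t s' - topGap2CoreAt F N ϑ D g₀ os p g k θlo θhi δlo δhi t s'

/-- Unfolding of the doubly-gapped top slot through def-T's `tstepOfRecordAt_apply`. [bookkeeping] -/
theorem topGap2SlotAt_apply (θlo θhi δlo δhi t : ℝ) (s' : SeqOfRecord F ϑ.ν ϑ.τ9.M g p.K (k + 1)) (V : GaugeField (F.P p.K) (k + 1) (SU N)) :
    topGap2SlotAt F N ϑ D g₀ os p g k θlo θhi δlo δhi t s' V =
      transportOfRecord F N p.K k (fun U => wGap2At F N ϑ θlo θhi δlo δhi p g k s' U V *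
        (chiSeqOfRecordAt F N ϑ.ν ϑ.τ9.M g p.K k (topLetter ϑ.ν θlo p g k) s'.init U * dressedSlotsOfDatum₉ F N ϑ D g₀ os t p g k s'.init U)) V :=
  tstepOfRecordAt_apply F N ϑ.ν ϑ.τ9.M (topLetter ϑ.ν θlo) (wGap2At F N ϑ θlo θhi δlo δhi) p g k _ s' V

/-- Face: the shell plus the doubly-gapped core is the pair-lettered term. [bookkeeping] -/
theorem topGap2ShellAt_add_topGap2CoreAt (θlo θ θhi δlo δ' δhi t : ℝ) (s' : SeqOfRecord F ϑ.ν ϑ.τ9.M g p.K (k + 1)) :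
    topGap2ShellAt F N ϑ D g₀ os p g k θlo θ θhi δlo δ' δhi t s' + topGap2CoreAt F N ϑ D g₀ os p g k θlo θhi δlo δhi t s' =
      topClassWeight2At F N ϑ D g₀ os p g k θ δ' t s' := by
  unfold topGap2ShellAt
  ring

/-- `0 ≤` the doubly-gapped top slot (`wGap2 ≥ 0`, `χ_k ≥ 0`, `slot_k ≥ 0`; def-T `transportOfRecord_nonneg`). [bookkeeping] -/
theorem topGap2SlotAt_nonneg (hζ0 : ∀ p g k s Pl Ql RS U V', 0 ≤ ϑ.ζ p g k s Pl Ql RS U V') (θlo θhi δlo δhi t : ℝ)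
    (s' : SeqOfRecord F ϑ.ν ϑ.τ9.M g p.K (k + 1)) (V : GaugeField (F.P p.K) (k + 1) (SU N)) :
    0 ≤ topGap2SlotAt F N ϑ D g₀ os p g k θlo θhi δlo δhi t s' V := by
  rw [topGap2SlotAt_apply]
  exact transportOfRecord_nonneg F N p.K k _ (fun U => mul_nonneg (wGap2At_nonneg F N ϑ p g k hζ0 θlo θhi δlo δhi s' U V)
    (mul_nonneg (chiSeqOfRecordAt_nonneg F N ϑ.ν ϑ.τ9.M g p.K k _ _ U)
      (dressedSlotsOfDatum₉_nonneg F N ϑ D g₀ os p g (wOfRecord₉_nonneg ϑ hζ0 p g) t k _ U))) V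

/-- (R) `0 ≤` the doubly-gapped core. [bookkeeping] -/
theorem topGap2CoreAt_nonneg (hζ0 : ∀ p g k s Pl Ql RS U V', 0 ≤ ϑ.ζ p g k s Pl Ql RS U V') (θlo θhi δlo δhi t : ℝ)
    (s' : SeqOfRecord F ϑ.ν ϑ.τ9.M g p.K (k + 1)) : 0 ≤ topGap2CoreAt F N ϑ D g₀ os p g k θlo θhi δlo δhi t s' :=
  integral_nonneg fun V => mul_nonneg (chiSeqOfRecordAt_nonneg F N ϑ.ν ϑ.τ9.M g p.K (k + 1) θlo s' V)
    (topGap2SlotAt_nonneg F N ϑ D g₀ os p g k hζ0 θlo θhi δlo δhi t s' V)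

/-- (R) the two-collar shell never exceeds the pair-lettered term (the doubly-gapped core is `≥ 0`). [bookkeeping] -/
theorem topGap2ShellAt_le_topClassWeight2At (hζ0 : ∀ p g k s Pl Ql RS U V', 0 ≤ ϑ.ζ p g k s Pl Ql RS U V') (θlo θ θhi δlo δ' δhi t : ℝ)
    (s' : SeqOfRecord F ϑ.ν ϑ.τ9.M g p.K (k + 1)) :
    topGap2ShellAt F N ϑ D g₀ os p g k θlo θ θhi δlo δ' δhi t s' ≤ topClassWeight2At F N ϑ D g₀ os p g k θ δ' t s' :=
  sub_le_self _ (topGap2CoreAt_nonneg F N ϑ D g₀ os p g k hζ0 θlo θhi δlo δhi t s')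

end Gap2Top

end Summit.QuantumFields.YangMills.Theorems.N21GappedTopPair13CoPH

end
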